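import Mathlib
import HarnessLib
import Summits.NavierStokesRegularity.NavierStokesRegularity.Theses.AxisymmetricExtremality
import Summits.NavierStokesRegularity.NavierStokesRegularity.Theorems.AxisymmetricExtremalityAxisymmetricKatoGlobalNoSwirlStratum
import Literature.Analysis.FluidPDE.AxisymmetricReflection
import Literature.Analysis.FluidPDE.SelfSimilar
import Literature.Analysis.FluidPDE.KatoMaximalTime

/-!
# Strategist s18-g3 (family `s`, independent census) — typed attempts for the crux
`AxisymmetricKatoGlobal` (item stmt-NavierStokesRegularity-15453) of route AxisymmetricExtremality.

Scratch file of the census `STRATEGY-CENSUS-s18.md`: every heading of the census has at least one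
signature here.  Nothing in this file is a route item; nothing here weakens or restates the crux.
All `theorem`s are sorry-free and use only landed declarations.
-/

noncomputable section

set_option linter.dupNamespace false

namespace Summit.NavierStokesRegularity.NavierStokesRegularity.Cruxes.AxisymmetricKatoGlobal.StrategistS18g3

open MeasureTheory Set Function
open Literature.Analysis.FluidPDE
open Summit.NavierStokesRegularity.NavierStokesRegularity.Theses.AxisymmetricExtremality

/-- The critical data space `Ḣ^{1/2}(ℝ³; ℂ³)` of the route. -/
abbrev H12 : Type :=
  Literature.Analysis.FunctionSpaces.HomSobolev (EuclideanSpace ℝ (Fin 3)) (EuclideanSpace ℂ (Fin 3)) (1 / 2 : ℝ)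

/-- Failure of Clay (A) at viscosity `ν`: the antecedent of `MinimalDatumPFold`, verbatim. -/
def ClayFails (ν : ℝ) : Prop :=
  ∃ v₀ : EuclideanSpace ℝ (Fin 3) → EuclideanSpace ℝ (Fin 3), ContDiff ℝ (⊤ : ℕ∞) v₀ ∧
    Literature.Analysis.FluidPDE.NSWave0.IsDivFree v₀ ∧ Literature.Analysis.FluidPDE.HasRapidSpatialDecay v₀ ∧
    ¬ ∃ (u : ℝ → EuclideanSpace ℝ (Fin 3) → EuclideanSpace ℝ (Fin 3)) (p : ℝ → EuclideanSpace ℝ (Fin 3) → ℝ),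
      Literature.Analysis.FluidPDE.IsSmoothOnHalfSpace u ∧ Literature.Analysis.FluidPDE.IsSmoothOnHalfSpace p ∧
      Literature.Analysis.FluidPDE.IsNavierStokesSolution ν 0 v₀ u p ∧ Literature.Analysis.FluidPDE.HasBoundedEnergy u

/-! ## 1. Weaker intermediate (family `s`, first heading)

`W0` = the weakest statement the deciding theorem `closes` can consume in place of the crux: it uses
`AxisymmetricKatoGlobal` only at ONE axisymmetric Rusin–Šverák minimal blow-up datum. -/

/-- **W0.** No Rusin–Šverák minimal blow-up datum is axisymmetric. -/
def NoAxisymMinimalDatum : Prop :=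
  ∀ ν : ℝ, 0 < ν → ∀ (u₀ : EuclideanSpace ℝ (Fin 3) → EuclideanSpace ℝ (Fin 3)) (g : H12),
    IsMinimalBlowupDatum ν u₀ g → IsAxisymmetric u₀ → False

/-- The crux implies W0 (so W0 is formally weaker). -/
theorem noAxisymMinimalDatum_of_crux (h : AxisymmetricKatoGlobal) : NoAxisymMinimalDatum :=
  fun ν hν u₀ g hmin hax => hmin.2.2.2.2 (h ν hν u₀ g hmin.1 hmin.2.1 hmin.2.2.1 (fun θ x => hax θ x))

/-- `closes` re-glued on W0: the route decides the summit from `MinimalDatumPFold`,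
`PFoldToAxisymmetric` (proved) and W0 alone (pure logic, as in the route's `closes`). -/
theorem closes_of_noAxisymMinimalDatum (h₂ : MinimalDatumPFold) (h₄ : PFoldToAxisymmetric)
    (h₀ : NoAxisymMinimalDatum) : NavierStokesRegularity := by
  show Literature.NS.NavierStokesExistenceSmoothR3
  intro ν hν u₀ hsm hdiv hdec
  by_contra hno
  obtain ⟨u₁, g, hmin, hax⟩ := h₄ ν hν (h₂ ν hν ⟨u₀, hsm, hdiv, hdec, hno⟩)
  exact h₀ ν hν u₁ g hmin (fun θ x => hax θ x)

/-- **The O(2) stratum of W0 is a theorem** (landed pieces only): a minimal blow-up datum cannot be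
axisymmetric AND equivariant under the meridian reflection `σ = reflY`, because such a field has no
swirl (`IsAxisymmetric.hasNoSwirl_of_reflY_eq`) and swirl-free axisymmetric `L³` data are global for
every `ν > 0` (`hasGlobalKatoSolution_of_isAxisymmetric_hasNoSwirl_viscosity`, landed). What is left
of W0 is exactly the SO(2)-equivariant, swirling case. -/
theorem no_O2_minimalDatum {ν : ℝ} (hν : 0 < ν)
    {u₀ : EuclideanSpace ℝ (Fin 3) → EuclideanSpace ℝ (Fin 3)} {g : H12}
    (hmin : IsMinimalBlowupDatum ν u₀ g) (hax : IsAxisymmetric u₀)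
    (hσ : ∀ x, u₀ (reflY x) = reflY (u₀ x)) : False :=
  hmin.2.2.2.2
    (Theorems.AxisymmetricKatoGlobal.NoSwirlStratum.hasGlobalKatoSolution_of_isAxisymmetric_hasNoSwirl_viscosity
      hν hmin.1 hmin.2.2.1 hax (hax.hasNoSwirl_of_reflY_eq hσ))

/-- The mirror image `σ·u₀ := σ ∘ u₀ ∘ σ` of an axisymmetric field is axisymmetric with the
opposite swirl: `Γ(σ·u₀)(x) = −Γ(u₀)(σ x)`.  (Consistency check for the census' "mirror pair"
scenario: nothing known excludes a minimal-data moduli space whose SO(2)-fixed locus is the pair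
`{u₀, σ·u₀}` swapped by `σ`.) -/
theorem swirl_mirror (u₀ : EuclideanSpace ℝ (Fin 3) → EuclideanSpace ℝ (Fin 3))
    (x : EuclideanSpace ℝ (Fin 3)) :
    swirl (fun y => reflY (u₀ (reflY y))) x = -swirl u₀ (reflY x) := by
  simp only [swirl, reflY]
  simp
  ring

/-! ### 1b. The "dihedral bypass" is a costume (route-level finding, typed)

Upgrading the symmetric-extremal crux from cyclic `C_p` to dihedral `D_p = ⟨R_{2π/p}, σ⟩` symmetry
removes `AxisymmetricKatoGlobal` from the glue — but the upgraded crux is EQUIVALENT TO THE SUMMIT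
given the dihedral analogue `DihedralToO2` of the landed `PFoldToAxisymmetric` argument. -/

/-- Dihedral analogue of `MinimalDatumPFold`: Clay failure forces, for unboundedly many `p`, a
minimal blow-up datum equivariant under `R_{2π/p}` and under the meridian reflection `σ`. -/
def MinimalDatumDihedral : Prop :=
  ∀ ν : ℝ, 0 < ν → ClayFails ν → ∀ N : ℕ, ∃ p : ℕ, N ≤ p ∧ 2 ≤ p ∧
    ∃ (u₀ : EuclideanSpace ℝ (Fin 3) → EuclideanSpace ℝ (Fin 3)) (g : H12),
      IsMinimalBlowupDatum ν u₀ g ∧ (∀ x, u₀ (rotZ (2 * Real.pi / p) x) = rotZ (2 * Real.pi / p) (u₀ x)) ∧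
        ∀ x, u₀ (reflY x) = reflY (u₀ x)

/-- Dihedral analogue of the PROVED crux `PFoldToAxisymmetric` (support-sized: the landed proof's
four stubs — compactness modulo Sim, axis pinning, dense-angle closure, a.e. upgrade — plus one
rotation normalising the reflection plane and closedness of `σ`-equivariance under `L³` limits). -/
def DihedralToO2 : Prop :=
  ∀ ν : ℝ, 0 < ν →
    (∀ N : ℕ, ∃ p : ℕ, N ≤ p ∧ 2 ≤ p ∧
      ∃ (u₀ : EuclideanSpace ℝ (Fin 3) → EuclideanSpace ℝ (Fin 3)) (g : H12),
        IsMinimalBlowupDatum ν u₀ g ∧ (∀ x, u₀ (rotZ (2 * Real.pi / p) x) = rotZ (2 * Real.pi / p) (u₀ x)) ∧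
          ∀ x, u₀ (reflY x) = reflY (u₀ x)) →
    ∃ (u₀ : EuclideanSpace ℝ (Fin 3) → EuclideanSpace ℝ (Fin 3)) (g : H12),
      IsMinimalBlowupDatum ν u₀ g ∧ IsAxisymmetric u₀ ∧ ∀ x, u₀ (reflY x) = reflY (u₀ x)

/-- Unconditionally (given `DihedralToO2`): dihedrally symmetric minimal blow-up data do NOT exist
for unboundedly many `p`, at any viscosity. -/
theorem not_frequently_dihedral (hL : DihedralToO2) {ν : ℝ} (hν : 0 < ν) :
    ¬ (∀ N : ℕ, ∃ p : ℕ, N ≤ p ∧ 2 ≤ p ∧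
      ∃ (u₀ : EuclideanSpace ℝ (Fin 3) → EuclideanSpace ℝ (Fin 3)) (g : H12),
        IsMinimalBlowupDatum ν u₀ g ∧ (∀ x, u₀ (rotZ (2 * Real.pi / p) x) = rotZ (2 * Real.pi / p) (u₀ x)) ∧
          ∀ x, u₀ (reflY x) = reflY (u₀ x)) := by
  intro h
  obtain ⟨u₀, g, hmin, hax, hσ⟩ := hL ν hν h
  exact no_O2_minimalDatum hν hmin hax hσ

/-- `MinimalDatumDihedral ⇒ summit` with NO regularity crux at all … -/
theorem summit_of_dihedral (hD : MinimalDatumDihedral) (hL : DihedralToO2) : NavierStokesRegularity := by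
  show Literature.NS.NavierStokesExistenceSmoothR3
  intro ν hν u₀ hsm hdiv hdec
  by_contra hno
  exact not_frequently_dihedral hL hν (hD ν hν ⟨u₀, hsm, hdiv, hdec, hno⟩)

/-- … and `summit ⇒ MinimalDatumDihedral` (vacuously): the upgraded crux IS the summit. -/
theorem dihedral_of_summit (hS : NavierStokesRegularity) : MinimalDatumDihedral := by
  intro ν hν hfail
  obtain ⟨v₀, hsm, hdiv, hdec, hno⟩ := hfail
  exact absurd (hS ν hν v₀ hsm hdiv hdec) hno

/-- For the record: the route's own crux `MinimalDatumPFold` is likewise a consequence of the summit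
(its antecedent is Clay failure); it is load-bearing only together with `AxisymmetricKatoGlobal`. -/
theorem pfold_of_summit (hS : NavierStokesRegularity) : MinimalDatumPFold := by
  intro ν hν hfail
  obtain ⟨v₀, hsm, hdiv, hdec, hno⟩ := hfail
  exact absurd (hS ν hν v₀ hsm hdiv hdec) hno

/-! ## 2. Decompositions (typed)

### Dec-B: the ancient-solution (KNSS) split — NOT an assembly of the crux.
`BoundedAncientAxisymLiouville` is the axisymmetric, bounded-swirl case of the KNSS conjecture
(open since 2009). Even the full conjecture only excludes TYPE I singularities (Seregin 2014,
Lecture Notes, p. 114: "validity of the conjecture would rule out Type I blowups"), and axisymmetric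
singularities are Type II (tree: `Seregin2020_axisymmetricSingularPoint_typeII_holds`; KNSS 2009 /
Seregin–Šverák 2009): the implication `BoundedAncientAxisymLiouville → AxisymmetricKatoGlobal` has
no proof and none is expected. Typed here to make the failure precise. -/

/-- KNSS Liouville conjecture, axisymmetric bounded-swirl case (ν = 1). -/
def BoundedAncientAxisymLiouville : Prop :=
  ∀ u : ℝ → EuclideanSpace ℝ (Fin 3) → EuclideanSpace ℝ (Fin 3),
    IsBoundedAncientMildSolution 1 u → (∀ t < 0, IsAxisymmetric (u t)) →
    (∃ C : ℝ, ∀ t < 0, ∀ x, |swirl (u t) x| ≤ C) →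
    ∃ b : EuclideanSpace ℝ (Fin 3), ∀ t < 0, u t =ᵐ[volume] fun _ => b

/-- The missing (and not expected) assembly of Dec-B. -/
def DecB_Assembly : Prop := BoundedAncientAxisymLiouville → AxisymmetricKatoGlobal

/-! ### Dec-C: the bounded-swirl split.  `LocalSwirlBound` (support-sized, provable from
`jia_sverak_2014_theorem_3_2_holds` + scaling + the local maximum principle for `Γ`) removes the
worry that Kato smoothing does not give `Γ ∈ L^∞`; the complementary piece is the crux minus a
lemma, i.e. still the whole open problem. -/

/-- **Sub₁ (support).** For a Kato solution from axisymmetric `L³` data on `[0,T)`, the swirl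
`Γ = x₀u₁ − x₁u₀` is bounded on `[t₀,T) × B_R` for every `0 < t₀ < T` and every `R` (far-field
regularity up to `T` by local-in-space short-time regularity at large scales, then the maximum
principle for `Γ` on a cylinder whose lateral boundary lies in the regular far field). -/
def LocalSwirlBound : Prop :=
  ∀ (ν T : ℝ), 0 < ν → 0 < T →
    ∀ (u₀ : EuclideanSpace ℝ (Fin 3) → EuclideanSpace ℝ (Fin 3)) (u : ℝ → EuclideanSpace ℝ (Fin 3) → EuclideanSpace ℝ (Fin 3)),
      MemLp u₀ 3 volume → IsWeaklyDivFree u₀ → IsAxisymmetric u₀ → IsKatoSolutionOn T ν u₀ u →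
      (∀ t ∈ Ioo 0 T, ContDiff ℝ (⊤ : ℕ∞) (u t)) →
      ∀ t₀ R : ℝ, 0 < t₀ → t₀ < T → ∃ M : ℝ, ∀ t ∈ Ico t₀ T, ∀ x : EuclideanSpace ℝ (Fin 3), ‖x‖ ≤ R → |swirl (u t) x| ≤ M

/-- **Sub₂ (= the crux given Sub₁).** -/
def DecC_Sub2 : Prop := LocalSwirlBound → AxisymmetricKatoGlobal

/-- Dec-C assembly (modus ponens; recorded only to show the split is honest but toothless). -/
theorem decC_assembly (h₁ : LocalSwirlBound) (h₂ : DecC_Sub2) : AxisymmetricKatoGlobal := h₂ h₁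

/-! ## 3. Strengthenings (typed) -/

/-- **S⁺₁.** All critical data are global (`ρ_max^pure(ν) = ⊤` for every `ν > 0`): full critical
Navier–Stokes regularity, strictly above the summit. -/
def AllCriticalDataGlobal : Prop := ∀ ν : ℝ, 0 < ν → rusinSverakRhoMaxPure ν = ⊤

/-- S⁺₁ implies the crux (unfolding of the threshold). -/
theorem crux_of_allCriticalDataGlobal (h : AllCriticalDataGlobal) : AxisymmetricKatoGlobal := by
  intro ν hν u₀ g hL3 hrep hdiv _hax
  exact hasGlobalKatoSolution_of_lt_rusinSverakRhoMaxPure hL3 hrep hdiv (by rw [h ν hν]; exact enorm_lt_top)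

/-- **S⁺₂.** Closedness of globality in the axisymmetric critical class (equivalent to the crux by
connectedness: small data are global and globality is open — Kato/Rusin–Šverák stability):
stated as sequential closedness under `Ḣ^{1/2}` convergence of representing classes. -/
def AxisymGlobalSetClosed : Prop :=
  ∀ ν : ℝ, 0 < ν →
    ∀ (u₀ : ℕ → EuclideanSpace ℝ (Fin 3) → EuclideanSpace ℝ (Fin 3)) (g : ℕ → H12)
      (v₀ : EuclideanSpace ℝ (Fin 3) → EuclideanSpace ℝ (Fin 3)) (g' : H12),
      (∀ k, MemLp (u₀ k) 3 volume ∧ (g k).Represents (Literature.Analysis.FunctionSpaces.EuclideanSpace.complexify ∘ u₀ k) ∧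
        IsWeaklyDivFree (u₀ k) ∧ IsAxisymmetric (u₀ k) ∧ HasGlobalKatoSolution ν (u₀ k)) →
      MemLp v₀ 3 volume → g'.Represents (Literature.Analysis.FunctionSpaces.EuclideanSpace.complexify ∘ v₀) →
      IsWeaklyDivFree v₀ → IsAxisymmetric v₀ →
      Filter.Tendsto (fun k => ‖g k - g'‖) Filter.atTop (nhds 0) →
      HasGlobalKatoSolution ν v₀

/-! ## 4. Negation side (typed obstruction list is in the census; one signature) -/

/-- The negation of the crux at `ν = 1` (by `Disproof.crux_iff_nu_one` all `ν` are equivalent):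
an axisymmetric `Ḣ^{1/2}` datum with finite Kato lifespan.  Any witness is Type II, not
(discretely) self-similar, with singular set on the axis (tree theorems quoted in the census). -/
def CruxNegationAtOne : Prop :=
  ∃ (u₀ : EuclideanSpace ℝ (Fin 3) → EuclideanSpace ℝ (Fin 3)) (g : H12),
    MemLp u₀ 3 volume ∧ g.Represents (Literature.Analysis.FunctionSpaces.EuclideanSpace.complexify ∘ u₀) ∧
      IsWeaklyDivFree u₀ ∧ IsAxisymmetric u₀ ∧ ¬ HasGlobalKatoSolution 1 u₀

theorem cruxNegationAtOne_iff : CruxNegationAtOne ↔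
    ¬ (∀ (u₀ : EuclideanSpace ℝ (Fin 3) → EuclideanSpace ℝ (Fin 3)) (g : H12),
        MemLp u₀ 3 volume → g.Represents (Literature.Analysis.FunctionSpaces.EuclideanSpace.complexify ∘ u₀) →
        IsWeaklyDivFree u₀ → IsAxisymmetric u₀ → HasGlobalKatoSolution 1 u₀) := by
  simp only [CruxNegationAtOne, not_forall, exists_prop]

end Summit.NavierStokesRegularity.NavierStokesRegularity.Cruxes.AxisymmetricKatoGlobal.StrategistS18g3

end
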